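import Summits.KontsevichZagierPeriods.KontsevichZagierPeriods.Theorems.LinRedNormalFormArrangementNormalFormStubRebaseSimplePosOneZeroOfPar
import Summits.KontsevichZagierPeriods.KontsevichZagierPeriods.Theorems.LinRedNormalFormArrangementNormalFormStubRebaseSimplePosOneZeroOfDouble

/-!
# `stub_rebaseSimplePosOneZero`: one-fibre rebase over a base of dimension `2`

(Line `janus-bands`, crux `ArrangementNormalForm`, stub `stub_rebaseSimplePosOneZero` —
`GS 1 1 → closure (GG 1 2 1)`; the registered stub itself, skeleton v11.)

A Janus band representation over a bounded rational polygon `(x, y)` with base factor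
`p(x)/∏(x − aⱼ)^{eⱼ} · 1/(y − ℓ₂(x))` (simple pole in the distinguished coordinate `y`) and ONE fibre
`t` (optional letter `1/(t − c(x, y))`, affine bounds) is congruent modulo `KZ.relations` to a
`ℤ`-combination of REBASED data (letters `y`-free, affine bounds `y`-free or exactly `y`).
Proof: the B-generic one-fibre case tree (`rebaseSimplePos_oneFibre_of_residual'`, c1 wave) reduced
the statement to parallel transverse bounds (`Hpar`) and double-corner bands (`Hdthick`/`Hdfar`,
`rebaseSimplePos_oneFibre_of_double'`, c2 wave 1); at `B = 1` both are discharged (c2 wave 2):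
`rebaseSimplePos_par_one` (trapezoid dissection + level splits, W10) and
`rebaseSimplePos_dthick_one` / `rebaseSimplePos_dfar_one` (corner calculus: normalisation, flat and
steep corner blow-ups, W9).
-/

noncomputable section

open Set MeasureTheory MvPolynomial
open Literature.NumberTheory.Transcendental Literature.ModelTheory.ExponentialFields

namespace Summit.KontsevichZagierPeriods.ArrangementNormalForm.JanusBands

/-- **stub_rebaseSimplePosOneZero** (line `janus-bands`, crux `ArrangementNormalForm`): the one-fibre
rebase over a two-dimensional base, `GS 1 1 → closure (GG 1 2 1)`, from
`rebaseSimplePos_oneFibre_of_double'` at `b = 0` fed with `rebaseSimplePos_par_one`,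
`rebaseSimplePos_dthick_one`, `rebaseSimplePos_dfar_one`. [Kontsevich–Zagier 2001, §1.2] -/
theorem stub_rebaseSimplePosOneZero (GS : ℕ → ℕ → Set KZ.FormalRep) (GG : ℕ → ℕ → ℕ → Set KZ.FormalRep) (hGS : ∀ b k, GS b k = {w : KZ.FormalRep | ∃ (m m' n₁ n₂ : ℕ) (s : KZ.IntegralRep (b + 1 + k)) (M : Fin m' → (Fin (b + 1) → ℚ) × ℚ) (L : Fin m → (Fin b → ℚ) × ℚ) (e : Fin m → ℕ) (p : MvPolynomial (Fin b) ℚ) (ℓ₁ ℓ₂ : (Fin b → ℚ) × ℚ) (a : Fin k → Option ((Fin (b + 1) → ℚ) × ℚ)) (lo hi : Fin k → Fin k ⊕ ((Fin (b + 1) → ℚ) × ℚ)), (n₁ = 0 ∨ n₂ = 0) ∧ n₂ = 1 ∧ Bornology.IsBounded s.domain ∧ s.domain = {z | (∀ j, 0 < ∑ i, ((M j).1 i : ℝ) * z (Fin.castAdd k i) + ((M j).2 : ℝ)) ∧ ∀ i, Sum.elim (fun j => z (Fin.natAdd (b + 1) j)) (fun c => ∑ i', (c.1 i' : ℝ) *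 z (Fin.castAdd k i') + (c.2 : ℝ)) (lo i) < z (Fin.natAdd (b + 1) i) ∧ z (Fin.natAdd (b + 1) i) < Sum.elim (fun j => z (Fin.natAdd (b + 1) j)) (fun c => ∑ i', (c.1 i' : ℝ) * z (Fin.castAdd k i') + (c.2 : ℝ)) (hi i)} ∧ EqOn s.integrand (fun z => MvPolynomial.aeval (fun i => z (Fin.castAdd k (Fin.castSucc i))) p / (∏ j, (∑ i, ((L j).1 i : ℝ) * z (Fin.castAdd k (Fin.castSucc i)) + ((L j).2 : ℝ)) ^ e j) * ((z (Fin.castAdd k (Fin.last b)) - (∑ i, (ℓ₁.1 i : ℝ) * z (Fin.castAdd k (Fin.castSucc i)) + (ℓ₁.2 : ℝ))) ^ n₁ / (z (Fin.castAdd k (Fin.last b)) - (∑ i, (ℓ₂.1 i : ℝ) * z (Fin.castAdd k (Fin.castSucc i)) + (ℓ₂.2 : ℝ))) ^ n₂) * ∏ i, (a i).elim 1 (fun c => 1 / (z (Fin.natAdd (b + 1) i) - (∑ i', (c.1 i' : ℝ) * z (Fin.castAdd k i') + (c.2 : ℝ))))) s.domain ∧ w = KZ.of s}) (hGG : ∀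 b σ k, GG b σ k = {w : KZ.FormalRep | ∃ (m m' n₁ n₂ : ℕ) (s : KZ.IntegralRep (b + 1 + k)) (M : Fin m' → (Fin (b + 1) → ℚ) × ℚ) (L : Fin m → (Fin b → ℚ) × ℚ) (e : Fin m → ℕ) (p : MvPolynomial (Fin b) ℚ) (ℓ₁ ℓ₂ : (Fin b → ℚ) × ℚ) (a : Fin k → Option ((Fin (b + 1) → ℚ) × ℚ)) (lo hi : Fin k → Fin k ⊕ ((Fin (b + 1) → ℚ) × ℚ)), (n₁ = 0 ∨ n₂ = 0) ∧ (σ = 2 → (∀ i c, a i = some c → c.1 (Fin.last b) = 0) ∧ (∀ i c, (lo i = Sum.inr c ∨ hi i = Sum.inr c) → (c.1 (Fin.last b) = 0 ∨ c = (Pi.single (Fin.last b) 1, 0)))) ∧ Bornology.IsBounded s.domain ∧ s.domain = {z | (∀ j, 0 < ∑ i, ((M j).1 i : ℝ) * z (Fin.castAdd k i) + ((M j).2 : ℝ)) ∧ ∀ i, Sum.elim (fun j => z (Fin.natAdd (b + 1) j)) (fun c => ∑ i', (c.1 i' : ℝ) * z (Fin.castAdd k i') + (c.2 : ℝ)) (lo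 i) < z (Fin.natAdd (b + 1) i) ∧ z (Fin.natAdd (b + 1) i) < Sum.elim (fun j => z (Fin.natAdd (b + 1) j)) (fun c => ∑ i', (c.1 i' : ℝ) * z (Fin.castAdd k i') + (c.2 : ℝ)) (hi i)} ∧ EqOn s.integrand (fun z => MvPolynomial.aeval (fun i => z (Fin.castAdd k (Fin.castSucc i))) p / (∏ j, (∑ i, ((L j).1 i : ℝ) * z (Fin.castAdd k (Fin.castSucc i)) + ((L j).2 : ℝ)) ^ e j) * ((z (Fin.castAdd k (Fin.last b)) - (∑ i, (ℓ₁.1 i : ℝ) * z (Fin.castAdd k (Fin.castSucc i)) + (ℓ₁.2 : ℝ))) ^ n₁ / (z (Fin.castAdd k (Fin.last b)) - (∑ i, (ℓ₂.1 i : ℝ) * z (Fin.castAdd k (Fin.castSucc i)) + (ℓ₂.2 : ℝ))) ^ n₂) * ∏ i, (a i).elim 1 (fun c => 1 / (z (Fin.natAdd (b + 1) i) - (∑ i', (c.1 i' : ℝ) * z (Fin.castAdd k i') + (c.2 : ℝ))))) s.domain ∧ w = KZ.of s}) : ∀ x ∈ GS 1 1, ∃ c ∈ AddSubgroup.closure (GG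 1 2 1), x - c ∈ KZ.relations :=
  rebaseSimplePos_oneFibre_of_double' GS GG hGS hGG 0 rebaseSimplePos_par_one
    (fun m L e ℓ₁ ℓ₂ m' s M p u v κ A => rebaseSimplePos_dthick_one m L e ℓ₁ ℓ₂ m' s M p u v κ A)
    (fun m L e ℓ₁ ℓ₂ m' s M p u v κ A => rebaseSimplePos_dfar_one m L e ℓ₁ ℓ₂ m' s M p u v κ A)

end Summit.KontsevichZagierPeriods.ArrangementNormalForm.JanusBands
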